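import Literature.Geometry.Symplectic.FoldFormsFourFoldsSteinGlue
import Literature.Geometry.Symplectic.ComplexStructureOrientation
import Literature.Geometry.Symplectic.GirouxContactPathAlgebra
import HarnessLib

/-!
# The contact form of a `J`-convex boundary is positive for the complex boundary orientation

Topic `Literature/Geometry/Symplectic`; namespace `Literature.Geometry.Symplectic`.  A proofs-only
file (no definition, no named fact), companion of `SteinBoundaryContactCondition.lean`, whose
docstring leaves open exactly this: *"Not addressed: the sign of `α ∧ dα` against the boundary
orientation (positivity of the contact structure, Gompf loc. cit.)"*.  Gompf (1998), §1: *"If these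
complex lines comprise a contact structure `ξ` on `M` that is positive — that is, if `α ∧ dα`
determines the boundary orientation of `M` (independently of choice of `α`) — then `X` has a
strictly pseudoconvex boundary"*; conversely (Cieliebak–Eliashberg 2012, Ch. 2), the complex
tangencies of the `J`-convex boundary of a Stein domain form a POSITIVE contact structure for the
boundary orientation of the complex orientation.

For a Stein structure `S` on `W` (`SteinStructure W`) and a boundary datum
`b : BoundaryData (𝓡∂ 4) W (𝓡 3)` (an abstract `3`-manifold `b.carrier` identified with `∂W`
by the embedding `b.incl`), the tree's canonical `1`-form on `b.carrier` is the pulled-back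
Liouville/contact form `β = incl^*(-d^ℂφ)` (`SteinStructure.boundaryContactForm`,
`FoldFormsFourFoldsGlueProofs.lean`; kernel = the pulled-back complex tangencies
`boundaryPlaneField S.J b`, `SteinStructure.boundaryContactForm_eq_zero_iff`).  We prove:

* `SteinStructure.wedge₁₂_boundaryContactForm_apply` — the `3`-form `β ∧ dβ`
  (`Literature.Geometry.Symplectic.wedge₁₂`, the normalisation used by `OpenBook.IsGirouxForm` and
  by the named facts `palf_stein_supportedByBoundaryOpenBook`,
  `steinRealisation_of_sorted_modelsOnFibred`) evaluates on `(u, v, w)` to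
  `(α ∧ ω)(Du, Dv, Dw) = α(Du) ω(Dv, Dw) - α(Dv) ω(Du, Dw) + α(Dw) ω(Du, Dv)`, `D = d(incl)`,
  `α = -d^ℂφ`, `ω = -dd^ℂφ` (naturality of `d`, `liouvilleForm_pullback`);
* `SteinStructure.dφ_pos_iff_apply_zero_neg` — at a boundary point, `dφ(n) > 0` iff `n` points
  out of `W` in the boundary chart (`n 0 < 0`): "outward" is intrinsic;
* `SteinStructure.linearIndependent_adaptedBoundaryFrame` — for `R ∈ T∂W` with `α(R) ≠ 0` and
  `v ∈ ξ ∖ 0`, the `J`-ADAPTED frame `(-JR, R, v, Jv) = (n, Jn, v, Jv)`, `n = -JR`, is a basis of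
  `T_xW`; here `dφ(n) = α(R)`, so `n` is outward iff `α(R) > 0`;
* `SteinStructure.exists_wedge₁₂_boundaryContactForm_eq_mul_det` — **MAIN**: for every boundary
  point `y`, every outward vector `n` (`dφ(n) > 0`) and every `J`-adapted basis
  `bJ = (e, Je, f, Jf)` of `T_{incl y}W` (`ComplexStructure.IsAdaptedBasis`, the bases defining the
  complex orientation, `ComplexStructureOrientation.lean`) there is `K > 0` with
  `(β ∧ dβ)_y(u₀, u₁, u₂) = K · det_{bJ}(n, Du₀, Du₁, Du₂)` for all frames `u` of `T_y ∂W`;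
* `SteinStructure.wedge₁₂_boundaryContactForm_pos_iff` — hence **`β ∧ dβ > 0` exactly on the
  frames `u` for which `(n, Du)` ("outward normal first") is positively oriented for the complex
  orientation**: the contact structure of the `J`-convex boundary is positive.

Proof of the main statement (pointwise linear algebra at `x = incl y`, Cieliebak–Eliashberg Ch. 2):
pick `R = Dr ∈ T∂W` with `α(R) > 0` (`exists_contactForm_ne_zero`, `exists_mfderiv_incl_eq`) and
`v = Dp ∈ ξ ∖ 0`, `Jv = Dq` (`ξ ≤ T∂W = im D`).  Then `b₀ = (-JR, R, v, Jv)` is an adapted basis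
and `f = (r, p, q)` a basis of `T_y∂W`; `(β ∧ dβ)(r, p, q) = α(R) ω(v, Jv) > 0` (`J`-convexity,
`contactForm_wedge_kahlerForm_apply_J`).  Both `u ↦ (β ∧ dβ)(u)` (`wedgeForm`) and
`u ↦ det_{b₀}(n, Du)` are alternating `3`-forms on the `3`-space `T_y∂W`, hence multiples of
`det_f` (`AlternatingMap.eq_smul_basis_det`), with the factors `(β ∧ dβ)(f) > 0` and
`det_{b₀}(n, R, v, Jv) = dφ(n)/α(R) > 0` (write `n = (dφ(n)/α(R)) (-JR) + t`, `t ∈ T∂W`, and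
four vectors of the `3`-space `T∂W` are dependent, `AlternatingMap.map_linearDependent`); finally
`det_{bJ} = det_{bJ}(b₀) · det_{b₀}` with `det_{bJ}(b₀) > 0` for two adapted bases
(`ComplexStructure.orientation_eq_of_isAdaptedBasis`, `Basis.orientation_eq_iff_det_pos`).

Use (named fact `palf_stein_supportedByBoundaryOpenBook`, `LefschetzSteinOpenBook.lean`): its
positivity clause asks `α ∧ dα > 0` on the frames of `∂X` coming from frames `v` of `∂ Base g`
with `det(∇ρ, v) > 0` (outward normal first, complex orientation of `Base g ⊂ ℂ²`); for the
canonical form `β` of a Stein structure this file reduces it to the statement that the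
identification `D(jA)` is compatible with the two complex orientations.

## References
* R. E. Gompf, *Handlebody construction of Stein surfaces*, Ann. of Math. 148 (1998), §1
  (positive contact structures and strictly pseudoconvex boundaries). [Gompf1998]
* K. Cieliebak, Ya. Eliashberg, *From Stein to Weinstein and back*, AMS Coll. Publ. 59 (2012),
  Ch. 2 (`J`-convex hypersurfaces; the complex orientation). [CieliebakEliashberg2012]
* H. Geiges, *An Introduction to Contact Topology*, CUP (2008), §1.1 (positive contact forms).
  [Geiges2008]
-/

noncomputable section

open scoped Manifold ContDiff Topology
open Set Function Module

namespace Literature.Geometry.Symplectic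

open Literature.Geometry.Kaehler Literature.Topology.FourManifolds

/-! ### Four vectors tangent to the boundary are dependent -/

/-- Four vectors of the boundary hyperplane `T∂W = {v | v 0 = 0}` (`dim = 3`) are linearly
dependent. [folklore] -/
theorem not_linearIndependent_of_mem_boundaryTangentSpace (v : Fin 4 → EuclideanSpace ℝ (Fin 4))
    (hv : ∀ i, v i ∈ (boundaryTangentSpace : Submodule ℝ (EuclideanSpace ℝ (Fin 4)))) :
    ¬LinearIndependent ℝ v := by
  intro h
  have h' : LinearIndependent ℝ fun i =>
      (⟨v i, hv i⟩ : (boundaryTangentSpace : Submodule ℝ (EuclideanSpace ℝ (Fin 4)))) :=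
    LinearIndependent.of_comp (Submodule.subtype _) h
  have hle := h'.fintype_card_le_finrank
  rw [finrank_boundaryTangentSpace, Fintype.card_fin] at hle
  omega

variable {W : Type*} [TopologicalSpace W] [ChartedSpace (EuclideanHalfSpace 4) W]
  [IsManifold (𝓡∂ 4) ∞ W] [CompactSpace W] [T2Space W]

namespace SteinStructure

/-! ### `β ∧ dβ` evaluated; outward vectors -/

/-- **`β ∧ dβ = (α ∧ ω) ∘ D` on frames**: for the boundary contact form `β = incl^*(-d^ℂφ)`,
`(β ∧ dβ)_y(u, v, w) = α(Du) ω(Dv, Dw) - α(Dv) ω(Du, Dw) + α(Dw) ω(Du, Dv)` with `D = d(incl)_y`,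
`α = -d^ℂφ`, `ω = -dd^ℂφ` at `incl y` (`β(u) = α(Du)` and `dβ(u, v) = ω(Du, Dv)`,
`liouvilleForm_pullback`). [folklore] -/
theorem wedge₁₂_boundaryContactForm_apply (S : SteinStructure W) (b : BoundaryData (𝓡∂ 4) W (𝓡 3))
    (y : b.carrier) (u v w : EuclideanSpace ℝ (Fin 3)) :
    wedge₁₂ (S.boundaryContactForm b y) (mextDeriv (S.boundaryContactForm b) y) u v w =
      S.contactForm (b.incl y) (mfderiv (𝓡 3) (𝓡∂ 4) b.incl y u) *
          S.kahlerForm (b.incl y) (mfderiv (𝓡 3) (𝓡∂ 4) b.incl y v)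
            (mfderiv (𝓡 3) (𝓡∂ 4) b.incl y w) -
        S.contactForm (b.incl y) (mfderiv (𝓡 3) (𝓡∂ 4) b.incl y v) *
          S.kahlerForm (b.incl y) (mfderiv (𝓡 3) (𝓡∂ 4) b.incl y u)
            (mfderiv (𝓡 3) (𝓡∂ 4) b.incl y w) +
        S.contactForm (b.incl y) (mfderiv (𝓡 3) (𝓡∂ 4) b.incl y w) *
          S.kahlerForm (b.incl y) (mfderiv (𝓡 3) (𝓡∂ 4) b.incl y u)
            (mfderiv (𝓡 3) (𝓡∂ 4) b.incl y v) := by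
  have h := liouvilleForm_pullback S b.isSmoothEmbedding.contMDiff
  have e1 := h.2.1 y
  have e2 := h.2.2 y
  simp only [wedge₁₂]
  exact congrArg₂ (· + ·) (congrArg₂ (· - ·) (congrArg₂ (· * ·) (e1 u) (e2 v w))
    (congrArg₂ (· * ·) (e1 v) (e2 u w))) (congrArg₂ (· * ·) (e1 w) (e2 u v))

omit [T2Space W] in
/-- **Outward is intrinsic**: at a boundary point, `dφ(n) > 0` iff `n 0 < 0` in the boundary
chart (`dφ = c · (v ↦ v 0)` with `c < 0` there, `dφ_apply_eq_mul_of_isBoundaryPoint`; the model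
half-space is `{v | 0 ≤ v 0}`, so `n 0 < 0` is "pointing out of `W`"). [folklore] -/
theorem dφ_pos_iff_apply_zero_neg (S : SteinStructure W) {x : W} (hx : (𝓡∂ 4).IsBoundaryPoint x)
    (n : EuclideanSpace ℝ (Fin 4)) : 0 < S.dφ x n ↔ n 0 < 0 := by
  obtain ⟨h1, h2⟩ := S.dφ_apply_eq_mul_of_isBoundaryPoint hx n
  rw [h1, mul_pos_iff]
  constructor
  · rintro (⟨-, hc⟩ | ⟨hn, -⟩)
    · exact absurd hc (not_lt.2 h2.le)
    · exact hn
  · exact fun hn => Or.inr ⟨hn, h2⟩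

omit [T2Space W] in
/-- `dφ(-JR) = α(R)`: the vector `n = -JR` is outward iff `α(R) > 0`. [folklore] -/
theorem dφ_neg_J_apply (S : SteinStructure W) (x : W) (R : EuclideanSpace ℝ (Fin 4)) :
    S.dφ x (-S.J x R) = S.contactForm x R := by
  rw [map_neg, contactForm_apply]

/-! ### The adapted boundary frame `(-JR, R, v, Jv)` -/

omit [T2Space W] in
/-- **The adapted boundary frame is a basis.**  At a boundary point `x`, for `R ∈ T_x∂W` with
`α(R) ≠ 0` and `v ∈ ξ_x ∖ 0`, the four vectors `(-JR, R, v, Jv)` are linearly independent: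
apply `dφ` (which kills `T∂W ∋ R, v, Jv` and gives `α(R) ≠ 0` on `-JR`), then `α` (which kills
`ξ ∋ v, Jv`), then use that `v, Jv` are independent (`J` has no real eigenvector). [folklore] -/
theorem linearIndependent_adaptedBoundaryFrame (S : SteinStructure W) {x : W}
    (hx : (𝓡∂ 4).IsBoundaryPoint x) {R v : EuclideanSpace ℝ (Fin 4)}
    (hR : R ∈ (boundaryTangentSpace : Submodule ℝ (EuclideanSpace ℝ (Fin 4))))
    (hαR : S.contactForm x R ≠ 0) (hv : v ∈ contactPlane S.J x) (hv0 : v ≠ 0) :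
    LinearIndependent ℝ ![-S.J x R, R, v, S.J x v] := by
  have hJv : S.J x v ∈ contactPlane S.J x := (S.J_mem_contactPlane_iff x v).2 hv
  have hdR : S.dφ x R = 0 := S.mfderiv_φ_apply_eq_zero hx ((mem_boundaryTangentSpace_iff R).1 hR)
  have hdv : S.dφ x v = 0 := S.dφ_apply_eq_zero hx hv
  have hdJv : S.dφ x (S.J x v) = 0 := S.dφ_apply_eq_zero hx hJv
  have hαv : S.contactForm x v = 0 := S.contactForm_apply_eq_zero hx hv
  have hαJv : S.contactForm x (S.J x v) = 0 := S.contactForm_apply_eq_zero hx hJv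
  rw [Fintype.linearIndependent_iff]
  intro g hg
  rw [Fin.sum_univ_four] at hg
  simp only [Matrix.cons_val_zero, Matrix.cons_val_one, Matrix.cons_val] at hg
  -- apply `dφ`
  have h0 : g 0 = 0 := by
    have h := congrArg (S.dφ x) hg
    rw [map_add, map_add, map_add, map_smul, map_smul, map_smul, map_smul, S.dφ_neg_J_apply, hdR,
      hdv, hdJv, map_zero, smul_zero, smul_zero, smul_zero, add_zero, add_zero, add_zero,
      smul_eq_mul] at h
    exact (mul_eq_zero.1 h).resolve_right hαR
  rw [h0, zero_smul, zero_add] at hg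
  -- apply `α`
  have h1 : g 1 = 0 := by
    have h := congrArg (S.contactForm x) hg
    rw [map_add, map_add, map_smul, map_smul, map_smul, hαv, hαJv, map_zero, smul_zero, smul_zero,
      add_zero, add_zero, smul_eq_mul] at h
    exact (mul_eq_zero.1 h).resolve_right hαR
  rw [h1, zero_smul, zero_add] at hg
  -- `v, Jv` are independent
  have hpair := (ComplexStructure.linearIndependent_pair
    (⟨(S.J x : EuclideanSpace ℝ (Fin 4) →ₗ[ℝ] EuclideanSpace ℝ (Fin 4)), S.J_sq x⟩ :
      ComplexStructure (EuclideanSpace ℝ (Fin 4))) hv0)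
  rw [LinearIndependent.pair_iff] at hpair
  obtain ⟨h2, h3⟩ := hpair (g 2) (g 3) hg
  intro i
  fin_cases i
  · exact h0
  · exact h1
  · exact h2
  · exact h3

omit [T2Space W] in
/-- **A reference triple of `T_y ∂W`.**  There are `r, p, q ∈ T_y(b.carrier)` with `α(Dr) > 0`,
`Dp ∈ ξ ∖ 0` and `Dq = J(Dp)` (`α ≠ 0` on `T∂W`, `exists_contactForm_ne_zero`; `ξ` is a
`2`-plane inside `T∂W = im D`, `exists_mfderiv_incl_eq`). [folklore] -/
theorem exists_boundaryReferenceTriple (S : SteinStructure W) (b : BoundaryData (𝓡∂ 4) W (𝓡 3))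
    (y : b.carrier) :
    ∃ r p q : EuclideanSpace ℝ (Fin 3),
      0 < S.contactForm (b.incl y) (mfderiv (𝓡 3) (𝓡∂ 4) b.incl y r) ∧
      mfderiv (𝓡 3) (𝓡∂ 4) b.incl y p ∈ contactPlane S.J (b.incl y) ∧
      mfderiv (𝓡 3) (𝓡∂ 4) b.incl y p ≠ 0 ∧
      mfderiv (𝓡 3) (𝓡∂ 4) b.incl y q = S.J (b.incl y) (mfderiv (𝓡 3) (𝓡∂ 4) b.incl y p) := by
  have hx : (𝓡∂ 4).IsBoundaryPoint (b.incl y) := b.incl_mem_boundary y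
  obtain ⟨u₀, hu₀, hα⟩ := S.exists_contactForm_ne_zero hx
  obtain ⟨v, hv, hv0⟩ := S.exists_mem_contactPlane_ne_zero (b.incl y)
  have hJv : S.J (b.incl y) v ∈ contactPlane S.J (b.incl y) := (S.J_mem_contactPlane_iff _ v).2 hv
  obtain ⟨p, hp⟩ := exists_mfderiv_incl_eq b y (contactPlane_le_boundaryTangentSpace S.J _ hv)
  obtain ⟨q, hq⟩ := exists_mfderiv_incl_eq b y (contactPlane_le_boundaryTangentSpace S.J _ hJv)
  obtain ⟨r₀, hr₀⟩ := exists_mfderiv_incl_eq b y hu₀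
  set D : EuclideanSpace ℝ (Fin 3) →L[ℝ] EuclideanSpace ℝ (Fin 4) := mfderiv (𝓡 3) (𝓡∂ 4) b.incl y
    with hD
  -- clean-typed copies (the obtained equations carry `TangentSpace`-typed coercions)
  have hpc : D p = v := hp
  have hqc : D q = S.J (b.incl y) v := hq
  have hrc : D r₀ = u₀ := hr₀
  have hp' : D p ∈ contactPlane S.J (b.incl y) := by rw [hpc]; exact hv
  have hp0 : D p ≠ 0 := by rw [hpc]; exact hv0
  have hq' : D q = S.J (b.incl y) (D p) := by rw [hqc, hpc]
  show ∃ r p q : EuclideanSpace ℝ (Fin 3), 0 < S.contactForm (b.incl y) (D r) ∧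
    D p ∈ contactPlane S.J (b.incl y) ∧ D p ≠ 0 ∧ D q = S.J (b.incl y) (D p)
  rcases lt_or_gt_of_ne hα with hneg | hpos
  · refine ⟨-r₀, p, q, ?_, hp', hp0, hq'⟩
    rw [map_neg, map_neg, hrc]
    linarith
  · refine ⟨r₀, p, q, ?_, hp', hp0, hq'⟩
    rw [hrc]
    exact hpos

/-! ### Main statement: `β ∧ dβ` is a positive multiple of the complex-orientation determinant -/

/-- **The contact form of the `J`-convex boundary is positive for the complex boundary
orientation, quantitatively.**  Let `y` be a point of the boundary manifold, `n` an outward vector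
at `incl y` (`dφ(n) > 0`) and `bJ = (e, Je, f, Jf)` ANY `J`-adapted basis of `T_{incl y}W`.  Then
there is a constant `K > 0` such that for every triple `u` of tangent vectors of `b.carrier` at `y`
`(β ∧ dβ)_y(u₀, u₁, u₂) = K · det_{bJ}(n, Du₀, Du₁, Du₂)`, `D = d(incl)_y`.
[cite: CieliebakEliashberg2012, Ch. 2] -/
theorem exists_wedge₁₂_boundaryContactForm_eq_mul_det (S : SteinStructure W)
    (b : BoundaryData (𝓡∂ 4) W (𝓡 3)) (y : b.carrier)
    {bJ : Basis (Fin 4) ℝ (EuclideanSpace ℝ (Fin 4))}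
    (hbJ : ComplexStructure.IsAdaptedBasis
      (S.J (b.incl y) : EuclideanSpace ℝ (Fin 4) →ₗ[ℝ] EuclideanSpace ℝ (Fin 4)) bJ)
    {n : EuclideanSpace ℝ (Fin 4)} (hn : 0 < S.dφ (b.incl y) n) :
    ∃ K : ℝ, 0 < K ∧ ∀ u : Fin 3 → EuclideanSpace ℝ (Fin 3),
      wedge₁₂ (S.boundaryContactForm b y) (mextDeriv (S.boundaryContactForm b) y)
          (u 0) (u 1) (u 2) =
        K * bJ.det ![n, mfderiv (𝓡 3) (𝓡∂ 4) b.incl y (u 0), mfderiv (𝓡 3) (𝓡∂ 4) b.incl y (u 1),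
          mfderiv (𝓡 3) (𝓡∂ 4) b.incl y (u 2)] := by
  have hx : (𝓡∂ 4).IsBoundaryPoint (b.incl y) := b.incl_mem_boundary y
  obtain ⟨r, p, q, hαr, hp, hp0, hq⟩ := S.exists_boundaryReferenceTriple b y
  have hW := S.wedge₁₂_boundaryContactForm_apply b y
  set β := S.boundaryContactForm b with hβ
  set D : EuclideanSpace ℝ (Fin 3) →L[ℝ] EuclideanSpace ℝ (Fin 4) := mfderiv (𝓡 3) (𝓡∂ 4) b.incl y
    with hD
  set J : EuclideanSpace ℝ (Fin 4) →L[ℝ] EuclideanSpace ℝ (Fin 4) := S.J (b.incl y) with hJdef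
  -- clean-typed copies (the lemma statements carry `TangentSpace`-typed coercions)
  have hq' : D q = J (D p) := hq
  have hpT : D p ∈ contactPlane S.J (b.incl y) := hp
  have hαr' : 0 < S.contactForm (b.incl y) (D r) := hαr
  have hJp : J (D p) ∈ contactPlane S.J (b.incl y) := (S.J_mem_contactPlane_iff _ (D p)).2 hpT
  -- the complex structure of `T_xW`
  set cJ : ComplexStructure (EuclideanSpace ℝ (Fin 4)) :=
    ⟨(J : EuclideanSpace ℝ (Fin 4) →ₗ[ℝ] EuclideanSpace ℝ (Fin 4)), S.J_sq (b.incl y)⟩ with hcJ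
  -- the adapted reference basis `b₀ = (-J(Dr), Dr, Dp, J(Dp))`
  have hli₀ : LinearIndependent ℝ ![-J (D r), D r, D p, J (D p)] :=
    S.linearIndependent_adaptedBoundaryFrame hx
      (mfderiv_apply_mem_boundaryTangentSpace b.incl hx r) hαr.ne' hp hp0
  have hcard₄ : Fintype.card (Fin 4) = finrank ℝ (EuclideanSpace ℝ (Fin 4)) := by simp
  set b₀ := basisOfLinearIndependentOfCardEqFinrank hli₀ hcard₄ with hb₀
  have hb₀c : (⇑b₀ : Fin 4 → EuclideanSpace ℝ (Fin 4)) = ![-J (D r), D r, D p, J (D p)] :=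
    coe_basisOfLinearIndependentOfCardEqFinrank hli₀ hcard₄
  have hb₀A : ComplexStructure.IsAdaptedBasis cJ.J b₀ := by
    constructor
    · show b₀ 1 = J (b₀ 0)
      rw [hb₀c]
      simp [hJdef, S.J_sq]
    · show b₀ 3 = J (b₀ 2)
      rw [hb₀c]
      simp
  -- the reference basis `f = (r, p, q)` of `T_y ∂W`
  have hli₃ : LinearIndependent ℝ ![r, p, q] := by
    have h3 : LinearIndependent ℝ (![-J (D r), D r, D p, J (D p)] ∘ Fin.succ) :=
      hli₀.comp _ (Fin.succ_injective _)
    have hfun : ((D : EuclideanSpace ℝ (Fin 3) →ₗ[ℝ] EuclideanSpace ℝ (Fin 4)) ∘ ![r, p, q]) =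
        ![-J (D r), D r, D p, J (D p)] ∘ Fin.succ := by
      funext i
      fin_cases i
      · rfl
      · rfl
      · exact hq
    exact LinearIndependent.of_comp (D : EuclideanSpace ℝ (Fin 3) →ₗ[ℝ] EuclideanSpace ℝ (Fin 4))
      (hfun ▸ h3)
  have hcard₃ : Fintype.card (Fin 3) = finrank ℝ (EuclideanSpace ℝ (Fin 3)) := by simp
  set f := basisOfLinearIndependentOfCardEqFinrank hli₃ hcard₃ with hf
  have hfc : (⇑f : Fin 3 → EuclideanSpace ℝ (Fin 3)) = ![r, p, q] :=
    coe_basisOfLinearIndependentOfCardEqFinrank hli₃ hcard₃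
  -- (1) `β ∧ dβ` is `w₀ · det_f` with `w₀ = α(Dr) ω(Dp, J Dp) > 0`
  set w₀ : ℝ := S.contactForm (b.incl y) (D r) * S.kahlerForm (b.incl y) (D p) (J (D p)) with hw₀
  have hw₀pos : 0 < w₀ := mul_pos hαr' (S.kahlerForm_self_J_pos _ hp0)
  have hWf : wedge₁₂ (β y) (mextDeriv β y) r p q = w₀ := by
    rw [hW r p q, hq]
    exact S.contactForm_wedge_kahlerForm_apply_J hx (D r) hp
  have hW1 : ∀ u : Fin 3 → EuclideanSpace ℝ (Fin 3),
      wedge₁₂ (β y) (mextDeriv β y) (u 0) (u 1) (u 2) = w₀ * f.det u := fun u => by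
    have h := (wedgeForm (β y) (mextDeriv β y)).toAlternatingMap.eq_smul_basis_det f
    have h' := congrArg
      (fun g : (EuclideanSpace ℝ (Fin 3)) [⋀^Fin 3]→ₗ[ℝ] ℝ => g u) h
    simp only [AlternatingMap.smul_apply, smul_eq_mul,
      ContinuousAlternatingMap.coe_toAlternatingMap] at h'
    have hu : (![u 0, u 1, u 2] : Fin 3 → EuclideanSpace ℝ (Fin 3)) = u := by
      funext i; fin_cases i <;> rfl
    rw [← hu, wedgeForm_apply, hu, hfc, wedgeForm_apply, hWf] at h'
    exact h'
  -- (2) `u ↦ det_{b₀}(n, Du)` is `c · det_f` with `c = dφ(n)/α(Dr) > 0`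
  set c : ℝ := S.dφ (b.incl y) n / S.contactForm (b.incl y) (D r) with hc
  have hcpos : 0 < c := div_pos hn hαr'
  set Φ : (EuclideanSpace ℝ (Fin 3)) [⋀^Fin 3]→ₗ[ℝ] ℝ :=
    (b₀.det.curryLeft n).compLinearMap
      (D : EuclideanSpace ℝ (Fin 3) →ₗ[ℝ] EuclideanSpace ℝ (Fin 4)) with hΦ
  have hΦapply : ∀ u : Fin 3 → EuclideanSpace ℝ (Fin 3),
      Φ u = b₀.det ![n, D (u 0), D (u 1), D (u 2)] := fun u => by
    have hDu : (Matrix.vecCons n fun i =>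
        (D : EuclideanSpace ℝ (Fin 3) →ₗ[ℝ] EuclideanSpace ℝ (Fin 4)) (u i)) =
        ![n, D (u 0), D (u 1), D (u 2)] := by
      funext i
      refine Fin.cases rfl (fun j => ?_) i
      fin_cases j <;> rfl
    rw [hΦ, AlternatingMap.compLinearMap_apply, AlternatingMap.curryLeft_apply_apply, hDu]
  have hf0 : f 0 = r := congrFun hfc 0
  have hf1 : f 1 = p := congrFun hfc 1
  have hf2 : f 2 = q := congrFun hfc 2
  have hΦf : Φ f = c := by
    rw [hΦapply, hf0, hf1, hf2]
    -- decompose `n = c • (-J (D r)) + t`, `t ∈ T∂W`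
    set t : EuclideanSpace ℝ (Fin 4) := n - c • (-J (D r)) with ht
    have hnt : n = c • (-J (D r)) + t := by rw [ht]; abel
    have hdt : S.dφ (b.incl y) t = 0 := by
      rw [ht, map_sub, map_smul, S.dφ_neg_J_apply, smul_eq_mul, hc,
        div_mul_cancel₀ _ hαr'.ne', sub_self]
    have htT : t ∈ (boundaryTangentSpace : Submodule ℝ (EuclideanSpace ℝ (Fin 4))) :=
      (mem_boundaryTangentSpace_iff t).2 ((S.mfderiv_φ_apply_eq_zero_iff hx t).1 hdt)
    have hdep : ¬LinearIndependent ℝ ![t, D r, D p, J (D p)] := by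
      refine not_linearIndependent_of_mem_boundaryTangentSpace _ fun i => ?_
      fin_cases i
      · exact htT
      · exact mfderiv_apply_mem_boundaryTangentSpace b.incl hx r
      · exact mfderiv_apply_mem_boundaryTangentSpace b.incl hx p
      · exact hJp.1
    rw [hq', hnt, b₀.det.map_vecCons_add, b₀.det.map_vecCons_smul,
      b₀.det.map_linearDependent _ hdep, add_zero, smul_eq_mul]
    have hself : (Matrix.vecCons (-J (D r)) ![D r, D p, J (D p)] :
        Fin 4 → EuclideanSpace ℝ (Fin 4)) = ⇑b₀ := hb₀c.symm
    rw [hself, b₀.det_self, mul_one]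
  have hΦ1 : ∀ u : Fin 3 → EuclideanSpace ℝ (Fin 3),
      b₀.det ![n, D (u 0), D (u 1), D (u 2)] = c * f.det u := fun u => by
    have h := Φ.eq_smul_basis_det f
    have h' := congrArg
      (fun g : (EuclideanSpace ℝ (Fin 3)) [⋀^Fin 3]→ₗ[ℝ] ℝ => g u) h
    simp only [AlternatingMap.smul_apply, smul_eq_mul] at h'
    rw [hΦapply, hΦf] at h'
    exact h'
  -- (3) two adapted bases: `det_{bJ} = det_{bJ}(b₀) · det_{b₀}`, `det_{bJ}(b₀) > 0`
  set dJ : ℝ := bJ.det b₀ with hdJ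
  have hdJpos : 0 < dJ :=
    (Basis.orientation_eq_iff_det_pos bJ b₀).1 (cJ.orientation_eq_of_isAdaptedBasis hbJ hb₀A)
  have hJ1 : ∀ F : Fin 4 → EuclideanSpace ℝ (Fin 4), bJ.det F = dJ * b₀.det F := fun F => by
    have h := bJ.det.eq_smul_basis_det b₀
    have h' := congrArg
      (fun g : (EuclideanSpace ℝ (Fin 4)) [⋀^Fin 4]→ₗ[ℝ] ℝ => g F) h
    simp only [AlternatingMap.smul_apply, smul_eq_mul] at h'
    exact h'
  -- assemble
  refine ⟨w₀ / (dJ * c), div_pos hw₀pos (mul_pos hdJpos hcpos), fun u => ?_⟩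
  show wedge₁₂ (β y) (mextDeriv β y) (u 0) (u 1) (u 2) =
    w₀ / (dJ * c) * bJ.det ![n, D (u 0), D (u 1), D (u 2)]
  rw [hW1 u, hJ1, hΦ1 u]
  field_simp

/-- **The contact structure of the `J`-convex boundary of a Stein domain is positive** (Gompf 1998,
§1; Cieliebak–Eliashberg 2012, Ch. 2): with `n` outward and `bJ` any `J`-adapted basis,
`(β ∧ dβ)_y(u₀, u₁, u₂) > 0 ↔ det_{bJ}(n, Du₀, Du₁, Du₂) > 0` — the `3`-form `β ∧ dβ` of the
boundary contact form is positive exactly on the frames which, preceded by the outward normal,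
are positive for the complex orientation. [cite: Gompf1998, §1] -/
theorem wedge₁₂_boundaryContactForm_pos_iff (S : SteinStructure W)
    (b : BoundaryData (𝓡∂ 4) W (𝓡 3)) (y : b.carrier)
    {bJ : Basis (Fin 4) ℝ (EuclideanSpace ℝ (Fin 4))}
    (hbJ : ComplexStructure.IsAdaptedBasis
      (S.J (b.incl y) : EuclideanSpace ℝ (Fin 4) →ₗ[ℝ] EuclideanSpace ℝ (Fin 4)) bJ)
    {n : EuclideanSpace ℝ (Fin 4)} (hn : 0 < S.dφ (b.incl y) n)
    (u : Fin 3 → EuclideanSpace ℝ (Fin 3)) :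
    0 < wedge₁₂ (S.boundaryContactForm b y) (mextDeriv (S.boundaryContactForm b) y)
        (u 0) (u 1) (u 2) ↔
      0 < bJ.det ![n, mfderiv (𝓡 3) (𝓡∂ 4) b.incl y (u 0), mfderiv (𝓡 3) (𝓡∂ 4) b.incl y (u 1),
        mfderiv (𝓡 3) (𝓡∂ 4) b.incl y (u 2)] := by
  obtain ⟨K, hK, h⟩ := S.exists_wedge₁₂_boundaryContactForm_eq_mul_det b y hbJ hn
  rw [h u]
  exact ⟨fun h' => pos_of_mul_pos_right h' hK.le, fun h' => mul_pos hK h'⟩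

/-- The same with "outward" read in the boundary chart (`n 0 < 0`). [cite: Gompf1998, §1] -/
theorem wedge₁₂_boundaryContactForm_pos_iff' (S : SteinStructure W)
    (b : BoundaryData (𝓡∂ 4) W (𝓡 3)) (y : b.carrier)
    {bJ : Basis (Fin 4) ℝ (EuclideanSpace ℝ (Fin 4))}
    (hbJ : ComplexStructure.IsAdaptedBasis
      (S.J (b.incl y) : EuclideanSpace ℝ (Fin 4) →ₗ[ℝ] EuclideanSpace ℝ (Fin 4)) bJ)
    {n : EuclideanSpace ℝ (Fin 4)} (hn : n 0 < 0) (u : Fin 3 → EuclideanSpace ℝ (Fin 3)) :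
    0 < wedge₁₂ (S.boundaryContactForm b y) (mextDeriv (S.boundaryContactForm b) y)
        (u 0) (u 1) (u 2) ↔
      0 < bJ.det ![n, mfderiv (𝓡 3) (𝓡∂ 4) b.incl y (u 0), mfderiv (𝓡 3) (𝓡∂ 4) b.incl y (u 1),
        mfderiv (𝓡 3) (𝓡∂ 4) b.incl y (u 2)] :=
  S.wedge₁₂_boundaryContactForm_pos_iff b y hbJ
    ((S.dφ_pos_iff_apply_zero_neg (b.incl_mem_boundary y) n).2 hn) u

/-- **`β ∧ dβ` vanishes on no frame** of the boundary manifold (the contact condition for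
`β = incl^*(-d^ℂφ)` on the abstract boundary `b.carrier`; the pointwise version on `T∂W ⊂ T W`
is `contactForm_wedge_kahlerForm_ne_zero`). [cite: Gompf1998, §1] -/
theorem wedge₁₂_boundaryContactForm_ne_zero (S : SteinStructure W)
    (b : BoundaryData (𝓡∂ 4) W (𝓡 3)) (y : b.carrier) {u : Fin 3 → EuclideanSpace ℝ (Fin 3)}
    (hu : LinearIndependent ℝ u) :
    wedge₁₂ (S.boundaryContactForm b y) (mextDeriv (S.boundaryContactForm b) y)
      (u 0) (u 1) (u 2) ≠ 0 := by
  have hx : (𝓡∂ 4).IsBoundaryPoint (b.incl y) := b.incl_mem_boundary y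
  -- an adapted basis and an outward vector exist
  obtain ⟨r, p, q, hαr, hp, hp0, -⟩ := S.exists_boundaryReferenceTriple b y
  have hli₀ := S.linearIndependent_adaptedBoundaryFrame hx
    (mfderiv_apply_mem_boundaryTangentSpace b.incl hx r) hαr.ne' hp hp0
  have hcard₄ : Fintype.card (Fin 4) = finrank ℝ (EuclideanSpace ℝ (Fin 4)) := by simp
  set b₀ := basisOfLinearIndependentOfCardEqFinrank hli₀ hcard₄ with hb₀
  have hb₀c := coe_basisOfLinearIndependentOfCardEqFinrank hli₀ hcard₄
  have hb₀A : ComplexStructure.IsAdaptedBasis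
      (S.J (b.incl y) : EuclideanSpace ℝ (Fin 4) →ₗ[ℝ] EuclideanSpace ℝ (Fin 4)) b₀ := by
    constructor
    · show b₀ 1 = S.J (b.incl y) (b₀ 0)
      rw [hb₀c]
      simp [S.J_sq]
    · show b₀ 3 = S.J (b.incl y) (b₀ 2)
      rw [hb₀c]
      simp
  set D : EuclideanSpace ℝ (Fin 3) →L[ℝ] EuclideanSpace ℝ (Fin 4) := mfderiv (𝓡 3) (𝓡∂ 4) b.incl y
    with hD
  have hαr' : S.contactForm (b.incl y) (D r) ≠ 0 := hαr.ne'
  have hn : 0 < S.dφ (b.incl y) (-S.J (b.incl y) (D r)) := by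
    rw [S.dφ_neg_J_apply]
    exact hαr
  obtain ⟨K, hK, h⟩ := S.exists_wedge₁₂_boundaryContactForm_eq_mul_det b y hb₀A hn
  rw [h u]
  refine mul_ne_zero hK.ne' ?_
  show b₀.det ![-S.J (b.incl y) (D r), D (u 0), D (u 1), D (u 2)] ≠ 0
  -- `(n, Du)` is a basis: `Du` spans `T∂W` and `n ∉ T∂W`
  have hinj : Injective D :=
    Manifold.IsImmersionAt.mfderiv_injective
      (b.isSmoothEmbedding.isImmersion.isImmersionAt y) (by simp)
  have hDu : LinearIndependent ℝ ![D (u 0), D (u 1), D (u 2)] := by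
    have hcomp : LinearIndependent ℝ
        ((D : EuclideanSpace ℝ (Fin 3) →ₗ[ℝ] EuclideanSpace ℝ (Fin 4)) ∘ u) :=
      hu.map' _ (LinearMap.ker_eq_bot.2 hinj)
    have hfun : ((D : EuclideanSpace ℝ (Fin 3) →ₗ[ℝ] EuclideanSpace ℝ (Fin 4)) ∘ u) =
        ![D (u 0), D (u 1), D (u 2)] := by
      funext i; fin_cases i <;> rfl
    rwa [hfun] at hcomp
  have hli : LinearIndependent ℝ ![-S.J (b.incl y) (D r), D (u 0), D (u 1), D (u 2)] := by
    rw [linearIndependent_finSucc]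
    refine ⟨hDu, fun hmem => ?_⟩
    -- the span of `Du` lies in `T∂W`, but `dφ(-J(Dr)) = α(Dr) ≠ 0`
    have hle : Submodule.span ℝ (Set.range ![D (u 0), D (u 1), D (u 2)]) ≤
        (boundaryTangentSpace : Submodule ℝ (EuclideanSpace ℝ (Fin 4))) := by
      rw [Submodule.span_le]
      rintro _ ⟨i, rfl⟩
      fin_cases i <;> exact mfderiv_apply_mem_boundaryTangentSpace b.incl hx _
    have h0 : (-S.J (b.incl y) (D r)) 0 = 0 := (mem_boundaryTangentSpace_iff _).1 (hle hmem)
    have h1 := S.mfderiv_φ_apply_eq_zero hx h0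
    exact hn.ne' h1
  set B := basisOfLinearIndependentOfCardEqFinrank hli hcard₄ with hB
  have hBc := coe_basisOfLinearIndependentOfCardEqFinrank hli hcard₄
  rw [← hBc]
  exact (b₀.isUnit_det B).ne_zero

end SteinStructure

end Literature.Geometry.Symplectic

end
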